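import Literature.Probability.RandomPlanarGeometry.HexSAWBrickWallStripFugacityTwoSided
import Literature.Probability.RandomPlanarGeometry.HexSAWBrickWallPolygonGlue
import Literature.Probability.RandomPlanarGeometry.SAWPatternTheorem
import HarnessLib

/-!
# Two attractive walls at every width: staircase switch walks and `(m·y^m)^{1/(2m+2T−1)} ≤ μ_T(y,y)`, hence `√y < μ_T(y,y)` (`T ≥ 1`, `y ≥ 1`)

Topic `Literature/Probability/RandomPlanarGeometry` (lane «pcv-sawmu»; the width-`T` version of `HexSAWBrickWallStripFugacityWidthOneSwitch.lean`
(width one); continues `HexSAWBrickWallStripFugacityTwoSided.lean` — `HexBW.stripZ₂ T n y z = C_{T,n}(y,z)` over the translation classes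
`HexBW.stripPairs T n` of the brick-wall strip `S_T = ℤ × {0,…,T}`, bottom weight on row `0` / odd abscissa (`HexBW.bottomVisits₀`), top weight on
row `T` / `x + T` even (`HexBW.topVisits₀`), the Fekete rate `HexBW.stripMuY₂ T y z = μ_T(y,z)`, `HexBW.tendsto_stripZ₂_rpow`).

Source frame: N. R. Beaton, M. Bousquet-Mélou, J. de Gier, H. Duminil-Copin, A. J. Guttmann, CMP 326 (2014) = arXiv:1109.0358v5, §3.2 (p. 10:
`C_{T,k}(y,z)`, Proposition 6: `μ_T(y,z)`; Proposition 7 / Corollary 8 treat ONE weighted wall).  Two attractive walls: E. J. Janse van Rensburg,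
E. Orlandini, A. L. Owczarek, A. Rechnitzer, S. G. Whittington 2005/06 (`ℤ³` slabs; = [16] of BBdGDCG14; not held).  I. G. Enting, I. Jensen,
LNP 775 (2009) §7.4.2, Fig. 7.10 (brickwork lattice).  N. Madras, G. Slade (1993) §1.2 (concatenation), §8.2 ((8.2.1)–(8.2.3)).

## What is proved (namespace `…SAW.HexBW`, `T ≥ 1`)

A **staircase switch** crosses the strip: from a bottom-weighted site `(x,0)` (`x` odd) it runs `(right, up)^T, right` — `(x,0) → (x+1,0) → (x+1,1) →
(x+2,1) → … → (x+T,T) → (x+T+1,T)` (`2T+1` steps; the vertical bonds `{(x+j+1,j),(x+j+1,j+1)}` exist because `x+2j+1` is even) — and lands on a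
TOP-weighted site (`x+T+1+T` even); symmetrically `(right, down)^T, right` from the top.  The PLAIN unit is two steps along the current wall.
A switch set `s ⊆ {0,…,n−1}` gives a self-avoiding walk of `S_T` from `(1,0)` of length `2n + (2T−1)·#s` with exactly `n+1` weighted vertices
(no site of an intermediate row, and no even-offset site of a wall, is weighted), and distinct sets give distinct classes:

* `tuX`/`tuY`/`tuLen`/`tuWalk` (units), `tsWalk`/`tsLen` (the walk and its length), `tsWalk_mem_saws`, `isBW_tsWalk`, `tsPair_mem_stripPairs`,
  `wSite`/`wPos` (weighted sites), `bottomVisits₀_add_topVisits₀_tsWalk` (`bc + tc = n+1`), `tsPair_injOn`;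
* **`choose_mul_pow_le_stripZ₂_self (1 ≤ T) (1 ≤ y) : C(n,k)·y^{n+1} ≤ C_{T,2n+(2T−1)k}(y,y)`**;
* **`rpow_le_stripMuY₂_self (1 ≤ T) (1 ≤ y) (1 ≤ m) : (m·y^m)^{1/(2m+2T−1)} ≤ μ_T(y,y)`**, `mul_pow_le_stripMuY₂_self_pow : m·y^m ≤ μ_T(y,y)^{2m+2T−1}`;
* **`sqrt_lt_stripMuY₂_self (1 ≤ T) (1 ≤ y) : √y < μ_T(y,y)`** for EVERY width `T ≥ 1` (take `m = ⌊y^T⌋₊ + 1`).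

The gain over `√y` from switching at width `T` is of order `y^{−(T−1)}` (one switch costs `2T−1` unweighted steps), against the half-plane's own
`μ(y) − √y = O(y^{−3/2})` (`HexSAWSurfaceSqrtSharpRec.lean`): so width one beats `μ(y)` for large `y` (`HexSAWBrickWallStripFugacityTwoWallWidthOne.lean`),
width two plausibly too, and from width three on this family alone cannot decide — not claimed.  Label (author's proposal): LANE LEMMA,
NEW-IN-WRITING (modest, S) for honeycomb strips; elementary.
-/

noncomputable section

open Finset Filter Topology Literature.Probability.LatticeModels Literature.Probability.Percolation SimpleGraph

namespace Literature.Probability.RandomPlanarGeometry.SAW.HexBW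

-- Membership in `Zd.saws 2 n` / `saws n` is only ever used through `Zd.mem_saws`.
attribute [local irreducible] Zd.saws saws

variable {y : ℝ} {T : ℕ}

/-- Two-coordinate extensionality for sites of `ℤ²` (local twin). [cite: MadrasSlade1993, §1.1] -/
private theorem site_ext₂' {x z : Site 2} (h0 : x 0 = z 0) (h1 : x 1 = z 1) : x = z :=
  funext fun i => by fin_cases i <;> assumption

/-! ### The two units at width `T` -/

/-- Abscissa offset at time `i`: plain `0,1,2,2,…`; staircase switch `⌈i/2⌉` capped at `T+1`. [cite: EntingJensen2009, §7.4.2, Fig. 7.10] -/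
def tuX (T : ℕ) : Bool → ℕ → ℤ
  | false, i => ((min i 2 : ℕ) : ℤ)
  | true, i => (((min i (2 * T + 1) + 1) / 2 : ℕ) : ℤ)

/-- Ordinate offset at time `i`: plain `0`; staircase switch `⌊i/2⌋` capped at `T`, upwards from the bottom (`sd = false`), downwards
from the top (`sd = true`). [cite: EntingJensen2009, §7.4.2, Fig. 7.10] -/
def tuY (T : ℕ) (sd : Bool) : Bool → ℕ → ℤ
  | false, _ => 0
  | true, i => if sd then -(((min (i / 2) T : ℕ) : ℤ)) else ((min (i / 2) T : ℕ) : ℤ)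

/-- Length of a unit: plain `2`, staircase switch `2T+1`. [cite: EntingJensen2009, §7.4.2, Fig. 7.10] -/
def tuLen (T : ℕ) : Bool → ℕ
  | false => 2
  | true => 2 * T + 1

/-- The unit walk from the origin (frozen after its length). [cite: EntingJensen2009, §7.4.2, Fig. 7.10] -/
def tuWalk (T : ℕ) (sd b : Bool) (i : ℕ) : Site 2 := ![tuX T b i, tuY T sd b i]

/-- Abscissa of the unit walk. [cite: EntingJensen2009, §7.4.2, Fig. 7.10] -/
@[simp] theorem tuWalk_apply_zero (T : ℕ) (sd b : Bool) (i : ℕ) : tuWalk T sd b i 0 = tuX T b i := rfl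

/-- Ordinate of the unit walk. [cite: EntingJensen2009, §7.4.2, Fig. 7.10] -/
@[simp] theorem tuWalk_apply_one (T : ℕ) (sd b : Bool) (i : ℕ) : tuWalk T sd b i 1 = tuY T sd b i := rfl

/-- The row of a side: `0` (bottom) or `T` (top). [cite: MadrasSlade1993, §8.2, eq. (8.2.1)] -/
def sideRow (T : ℕ) (sd : Bool) : ℤ := if sd then (T : ℤ) else 0

/-- The parity of a weighted site of a side: bottom-weighted sites have `x + row` odd, top-weighted ones `x + row` even. [cite: BeatonBousquetMelouDeGierDuminilCopinGuttmann2014, §3.2 (arXiv v5 p. 10: bc(ω), tc(ω))] -/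
def sidePar (sd : Bool) : ℤ := if sd then 0 else 1

/-- The side reached after a unit: unchanged (plain) or the other wall (switch). [cite: EntingJensen2009, §7.4.2, Fig. 7.10] -/
def nside : Bool → Bool → Bool
  | sd, false => sd
  | sd, true => !sd

/-- `2 ≤ tuLen` (`T ≥ 1`). [cite: EntingJensen2009, §7.4.2, Fig. 7.10] -/
theorem two_le_tuLen (hT : 1 ≤ T) (b : Bool) : 2 ≤ tuLen T b := by
  cases b
  · simp only [tuLen, le_refl]
  · simp only [tuLen]; omega

/-- `1 ≤ tuLen`. [cite: EntingJensen2009, §7.4.2, Fig. 7.10] -/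
theorem one_le_tuLen (T : ℕ) (b : Bool) : 1 ≤ tuLen T b := by
  cases b
  · simp only [tuLen]; omega
  · simp only [tuLen]; omega

/-- The unit starts at the origin. [cite: EntingJensen2009, §7.4.2, Fig. 7.10] -/
theorem tuWalk_zero (T : ℕ) (sd b : Bool) : tuWalk T sd b 0 = 0 :=
  site_ext₂' (by cases b <;> simp [tuX]) (by cases b <;> cases sd <;> simp [tuY])

/-- `0 ≤ tuX`. [cite: EntingJensen2009, §7.4.2, Fig. 7.10] -/
theorem tuX_nonneg (T : ℕ) (b : Bool) (i : ℕ) : 0 ≤ tuX T b i := by cases b <;> simp only [tuX] <;> positivity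

/-- `tuX` never exceeds its final value. [cite: EntingJensen2009, §7.4.2, Fig. 7.10] -/
theorem tuX_le (T : ℕ) (b : Bool) (i : ℕ) : tuX T b i ≤ tuX T b (tuLen T b) := by
  cases b
  · simp only [tuX, tuLen]; push_cast; omega
  · simp only [tuX, tuLen]; push_cast; omega

/-- `1 ≤ tuX` from time `1` on. [cite: EntingJensen2009, §7.4.2, Fig. 7.10] -/
theorem one_le_tuX (T : ℕ) (b : Bool) {i : ℕ} (hi : 1 ≤ i) : 1 ≤ tuX T b i := by
  cases b
  · simp only [tuX]; push_cast; omega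
  · simp only [tuX]; push_cast; omega

/-- The plain unit ends two columns to the right, the switch `T+1` columns. [cite: EntingJensen2009, §7.4.2, Fig. 7.10] -/
theorem tuX_tuLen (T : ℕ) (b : Bool) : tuX T b (tuLen T b) = if b then (T : ℤ) + 1 else 2 := by
  cases b
  · simp [tuX, tuLen]
  · simp only [tuX, tuLen, min_self, ite_true]
    push_cast
    omega

/-- The row reached at the end of a unit: unchanged (plain) or the other side (switch). [cite: EntingJensen2009, §7.4.2, Fig. 7.10] -/
theorem sideRow_add_tuY_tuLen (T : ℕ) (sd b : Bool) :
    sideRow T sd + tuY T sd b (tuLen T b) = sideRow T (nside sd b) := by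
  cases b
  · cases sd
    · simp [tuY, sideRow, nside]
    · simp [tuY, sideRow, nside]
  · cases sd
    · simp only [tuY, tuLen, sideRow, nside, Bool.false_eq_true, ite_false, Bool.not_false, ite_true]
      push_cast; omega
    · simp only [tuY, tuLen, sideRow, nside, ite_true, Bool.not_true, Bool.false_eq_true, ite_false]
      push_cast; omega

/-- At time `2` the abscissa offset tells the unit apart: `2` for plain, `1` for switch (`T ≥ 1`). [cite: EntingJensen2009, §7.4.2, Fig. 7.10] -/
theorem tuX_two (hT : 1 ≤ T) (b : Bool) : tuX T b 2 = if b then 1 else 2 := by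
  cases b
  · simp [tuX]
  · simp only [tuX, ite_true]
    push_cast
    omega

/-- The unit is frozen after its length. [cite: MadrasSlade1993, §1.1] -/
theorem tuWalk_of_le (T : ℕ) (sd b : Bool) {i : ℕ} (hi : tuLen T b ≤ i) : tuWalk T sd b i = tuWalk T sd b (tuLen T b) := by
  refine site_ext₂' ?_ ?_
  · rw [tuWalk_apply_zero, tuWalk_apply_zero]
    cases b <;> simp only [tuX, tuLen] at hi ⊢
    · rw [min_eq_right hi, min_self]
    · rw [min_eq_right hi, min_self]
  · rw [tuWalk_apply_one, tuWalk_apply_one]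
    cases b <;> simp only [tuY, tuLen] at hi ⊢
    have h1 : min (i / 2) T = T := min_eq_right (by omega)
    have h2 : min ((2 * T + 1) / 2) T = T := by rw [show (2 * T + 1) / 2 = T by omega, min_self]
    rw [h1, h2]

/-- The rows visited by a unit started on a side of `S_T` stay in `[0, T]`. [cite: MadrasSlade1993, §8.2, eq. (8.2.1)] -/
theorem tuY_row (T : ℕ) (sd b : Bool) (i : ℕ) : 0 ≤ sideRow T sd + tuY T sd b i ∧ sideRow T sd + tuY T sd b i ≤ (T : ℤ) := by
  cases b
  · cases sd
    · simp only [tuY, sideRow, Bool.false_eq_true, ite_false, add_zero]; omega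
    · simp only [tuY, sideRow, ite_true, add_zero]; omega
  · cases sd
    · simp only [tuY, sideRow, Bool.false_eq_true, ite_false]; push_cast; omega
    · simp only [tuY, sideRow, ite_true]; push_cast; omega

/-- **The unit placed at a weighted site of its side steps along brick-wall bonds**: the switch's vertical bonds sit at columns of the right
parity. [cite: EntingJensen2009, §7.4.2, Fig. 7.10 (vertical bonds {(x,y),(x,y+1)} with x+y even)] -/
theorem tuWalk_adj {a : Site 2} {sd : Bool} (ha0 : (a 0 + a 1) % 2 = sidePar sd) (ha1 : a 1 = sideRow T sd) (b : Bool) {i : ℕ}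
    (hi : i < tuLen T b) : brickWallGraph.Adj (a + tuWalk T sd b i) (a + tuWalk T sd b (i + 1)) := by
  rw [brickWallGraph_adj_coord]
  simp only [Pi.add_apply, tuWalk_apply_zero, tuWalk_apply_one]
  cases b
  · simp only [tuLen] at hi
    simp only [tuX, tuY]
    left
    constructor
    · left; push_cast; omega
    · trivial
  · simp only [tuLen] at hi
    rcases Nat.even_or_odd i with ⟨j, rfl⟩ | ⟨j, rfl⟩
    · -- horizontal step `2j → 2j+1`
      left
      constructor
      · left
        simp only [tuX]; push_cast; omega
      · cases sd
        · simp only [tuY, Bool.false_eq_true, ite_false]; push_cast; omega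
        · simp only [tuY, ite_true]; push_cast; omega
    · -- vertical step `2j+1 → 2j+2`, `j < T`
      right
      constructor
      · simp only [tuX]; push_cast; omega
      · cases sd
        · simp only [sidePar, sideRow, tuX, tuY, Bool.false_eq_true, ite_false] at ha0 ha1 ⊢
          left; push_cast; omega
        · simp only [sidePar, sideRow, tuX, tuY, ite_true] at ha0 ha1 ⊢
          right; push_cast; omega

/-- The unit is injective on `{0,…,tuLen}`. [cite: MadrasSlade1993, §1.1] -/
theorem tuWalk_injOn (T : ℕ) (sd b : Bool) : Set.InjOn (tuWalk T sd b) {i | i ≤ tuLen T b} := by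
  intro i hi j hj h
  simp only [Set.mem_setOf_eq] at hi hj
  have h0 := congrFun h 0
  have h1 := congrFun h 1
  simp only [tuWalk_apply_zero, tuWalk_apply_one] at h0 h1
  cases b <;> simp only [tuLen] at hi hj <;> simp only [tuX, tuY] at h0 h1
  · rw [min_eq_left hi, min_eq_left hj] at h0; exact_mod_cast h0
  · rw [min_eq_left hi, min_eq_left hj] at h0
    rw [min_eq_left (by omega : i / 2 ≤ T), min_eq_left (by omega : j / 2 ≤ T)] at h1
    have h0' : (i + 1) / 2 = (j + 1) / 2 := by exact_mod_cast h0
    have h1' : i / 2 = j / 2 := by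
      cases sd
      · simp only [Bool.false_eq_true, ite_false] at h1; exact_mod_cast h1
      · simp only [ite_true, neg_inj] at h1; exact_mod_cast h1
    omega

/-- The unit is a self-avoiding walk of `ℤ²` (adjacency read off the copy placed at a weighted site of its side). [cite: MadrasSlade1993, §1.1] -/
theorem tuWalk_mem_saws (T : ℕ) (sd b : Bool) : tuWalk T sd b ∈ Zd.saws 2 (tuLen T b) := by
  rw [Zd.mem_saws]
  refine ⟨tuWalk_zero T sd b, fun i hi => tuWalk_of_le T sd b hi, fun i hi => ?_, tuWalk_injOn T sd b⟩
  set a : Site 2 := ![sidePar sd - sideRow T sd, sideRow T sd] with ha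
  have h := zd_adj_of_adj (tuWalk_adj (T := T) (a := a) (sd := sd) (by simp [ha, sidePar]; split_ifs <;> omega) (by simp [ha]) b hi)
  rwa [add_comm a, add_comm a, Zd.zdGraph_adj_add_right] at h

/-! ### Weighted sites -/

/-- A site of `S_T` is WEIGHTED if it is bottom-weighted (row `0`, odd abscissa) or top-weighted (row `T`, `x + T` even).
[cite: BeatonBousquetMelouDeGierDuminilCopinGuttmann2014, §3.2 (arXiv v5 p. 10: bc(ω) and tc(ω))] -/
def wSite (T : ℕ) (v : Site 2) : Prop := (v 1 = 0 ∧ v 0 % 2 = 1) ∨ (v 1 = (T : ℤ) ∧ (v 0 + T) % 2 = 0)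

/-- The weight test is decidable. [cite: BeatonBousquetMelouDeGierDuminilCopinGuttmann2014, §3.2 (arXiv v5 p. 10)] -/
instance wSite.decidable (T : ℕ) (v : Site 2) : Decidable (wSite T v) := by unfold wSite; infer_instance

/-- Weighted sites at the positive times `1,…,N` of a placed walk. [cite: BeatonBousquetMelouDeGierDuminilCopinGuttmann2014, §3.2 (arXiv v5 p. 10)] -/
def wPos (T : ℕ) (a : Site 2) (υ : ℕ → Site 2) (N : ℕ) : ℕ := ∑ j ∈ range N, if wSite T (a + υ (j + 1)) then 1 else 0

/-- On a wall row the weight test is a parity test (`T ≥ 1`). [cite: BeatonBousquetMelouDeGierDuminilCopinGuttmann2014, §3.2 (arXiv v5 p. 10)] -/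
theorem wSite_iff_of_row (hT : 1 ≤ T) {v : Site 2} {sd : Bool} (hv : v 1 = sideRow T sd) :
    wSite T v ↔ (v 0 + v 1) % 2 = sidePar sd := by
  unfold wSite
  cases sd
  · simp only [sideRow, sidePar, Bool.false_eq_true, ite_false] at hv ⊢; omega
  · simp only [sideRow, sidePar, ite_true] at hv ⊢; omega

/-- No site strictly between the walls is weighted. [cite: BeatonBousquetMelouDeGierDuminilCopinGuttmann2014, §3.2 (arXiv v5 p. 10)] -/
theorem not_wSite_of_between {v : Site 2} (h0 : 0 < v 1) (hT : v 1 < (T : ℤ)) : ¬ wSite T v := by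
  unfold wSite; omega

/-- The endpoint of a unit placed at a weighted site of its side is a weighted site of the side reached (parity bookkeeping; `T ≥ 1`).
[cite: EntingJensen2009, §7.4.2, Fig. 7.10] -/
theorem tuWalk_end_par (hT : 1 ≤ T) {a : Site 2} {sd : Bool} (ha0 : (a 0 + a 1) % 2 = sidePar sd) (ha1 : a 1 = sideRow T sd)
    (b : Bool) :
    wSite T (a + tuWalk T sd b (tuLen T b)) ∧
      ((a + tuWalk T sd b (tuLen T b)) 0 + (a + tuWalk T sd b (tuLen T b)) 1) % 2 = sidePar (nside sd b) ∧
      (a + tuWalk T sd b (tuLen T b)) 1 = sideRow T (nside sd b) := by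
  have hrow : (a + tuWalk T sd b (tuLen T b)) 1 = sideRow T (nside sd b) := by
    rw [Pi.add_apply, tuWalk_apply_one, ha1]; exact sideRow_add_tuY_tuLen T sd b
  have hpar : ((a + tuWalk T sd b (tuLen T b)) 0 + (a + tuWalk T sd b (tuLen T b)) 1) % 2 = sidePar (nside sd b) := by
    rw [hrow, Pi.add_apply, tuWalk_apply_zero, tuX_tuLen]
    cases b
    · cases sd
      · simp only [sidePar, sideRow, nside, Bool.false_eq_true, ite_false] at ha0 ha1 ⊢; omega
      · simp only [sidePar, sideRow, nside, Bool.false_eq_true, ite_false, ite_true] at ha0 ha1 ⊢; omega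
    · cases sd
      · simp only [sidePar, sideRow, nside, Bool.false_eq_true, ite_false, ite_true, Bool.not_false] at ha0 ha1 ⊢; omega
      · simp only [sidePar, sideRow, nside, ite_true, Bool.not_true, Bool.false_eq_true, ite_false] at ha0 ha1 ⊢; omega
  exact ⟨(wSite_iff_of_row hT hrow).2 hpar, hpar, hrow⟩

/-- **Each unit placed at a weighted site of its side adds exactly one weighted site** (its endpoint); `T ≥ 1`. [cite: BeatonBousquetMelouDeGierDuminilCopinGuttmann2014, §3.2 (arXiv v5 p. 10)] -/
theorem sum_tuWalk_wSite (hT : 1 ≤ T) {a : Site 2} {sd : Bool} (ha0 : (a 0 + a 1) % 2 = sidePar sd) (ha1 : a 1 = sideRow T sd) (b : Bool) :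
    ∑ j ∈ range (tuLen T b), (if wSite T (a + tuWalk T sd b (j + 1)) then 1 else 0) = 1 := by
  obtain ⟨L, hL⟩ : ∃ L, tuLen T b = L + 1 := ⟨tuLen T b - 1, by have := two_le_tuLen hT b; omega⟩
  rw [hL, Finset.sum_range_succ, Finset.sum_eq_zero fun j hj => ?_, zero_add, if_pos ?_]
  · -- the endpoint is weighted
    rw [← hL]
    exact (tuWalk_end_par hT ha0 ha1 b).1
  · -- interior sites are not weighted
    have hjL : j < L := Finset.mem_range.1 hj
    rw [if_neg]
    cases b
    · simp only [tuLen] at hL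
      have hj0 : j = 0 := by omega
      subst hj0
      rw [wSite_iff_of_row hT (sd := sd) (by rw [Pi.add_apply, tuWalk_apply_one]; simp [tuY, ha1])]
      simp only [Pi.add_apply, tuWalk_apply_zero, tuWalk_apply_one, tuX, tuY, add_zero]
      push_cast
      omega
    · simp only [tuLen] at hL
      have hL' : L = 2 * T := by omega
      subst hL'
      intro hw
      unfold wSite at hw
      simp only [Pi.add_apply, tuWalk_apply_zero, tuWalk_apply_one, tuX, tuY] at hw
      rw [min_eq_left (by omega : j + 1 ≤ 2 * T + 1), min_eq_left (by omega : (j + 1) / 2 ≤ T)] at hw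
      cases sd
      · simp only [sideRow, sidePar, Bool.false_eq_true, ite_false] at ha0 ha1 hw; push_cast at hw; omega
      · simp only [sideRow, sidePar, ite_true] at ha0 ha1 hw; push_cast at hw; omega

/-! ### Switch walks at width `T` -/

/-- **The staircase switch walk** of the switch set `s` with `n` units, started on side `sd` at unit index `i₀` (from the origin, frozen at
the end). [cite: MadrasSlade1993, §1.2 (concatenation); EntingJensen2009, §7.4.2, Fig. 7.10] -/
def tsWalk (T : ℕ) (s : Finset ℕ) : ℕ → Bool → ℕ → (ℕ → Site 2)
  | 0, _, _ => fun _ => 0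
  | n + 1, sd, i₀ => Zd.concatWalk (tuLen T (decide (i₀ ∈ s))) (tuWalk T sd (decide (i₀ ∈ s)))
      (tsWalk T s n (nside sd (decide (i₀ ∈ s))) (i₀ + 1))

/-- The length of the switch walk: `Σ_{i₀ ≤ i < i₀+n} (2 + (2T−1)[i ∈ s])`. [cite: MadrasSlade1993, §1.2] -/
def tsLen (T : ℕ) (s : Finset ℕ) (i₀ n : ℕ) : ℕ := ∑ i ∈ range n, tuLen T (decide (i₀ + i ∈ s))

/-- Unfolding the length. [cite: MadrasSlade1993, §1.2] -/
theorem tsLen_succ (T : ℕ) (s : Finset ℕ) (i₀ n : ℕ) :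
    tsLen T s i₀ (n + 1) = tuLen T (decide (i₀ ∈ s)) + tsLen T s (i₀ + 1) n := by
  rw [tsLen, tsLen, Finset.sum_range_succ', add_comm, Nat.add_zero]
  congr 1
  exact Finset.sum_congr rfl fun i _ => by rw [show i₀ + (i + 1) = i₀ + 1 + i by omega]

/-- `tsLen T s i₀ 0 = 0`. [cite: MadrasSlade1993, §1.2] -/
@[simp] theorem tsLen_zero (T : ℕ) (s : Finset ℕ) (i₀ : ℕ) : tsLen T s i₀ 0 = 0 := by simp [tsLen]

/-- **Length = `2n + (2T−1)·#s`** for a switch set `s ⊆ {0,…,n−1}` (`T ≥ 1`). [cite: MadrasSlade1993, §8.2] -/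
theorem tsLen_eq (hT : 1 ≤ T) (n : ℕ) {s : Finset ℕ} (hs : s ⊆ range n) : tsLen T s 0 n = 2 * n + (2 * T - 1) * #s := by
  have e : ∀ i, tuLen T (decide (0 + i ∈ s)) = 2 + (if i ∈ s then 2 * T - 1 else 0) := by
    intro i
    rw [Nat.zero_add]
    by_cases h : i ∈ s
    · simp only [h, decide_true, tuLen, ite_true]; omega
    · simp only [h, decide_false, tuLen, ite_false, add_zero]
  rw [tsLen, Finset.sum_congr rfl fun i _ => e i, Finset.sum_add_distrib, Finset.sum_const, Finset.card_range,
    smul_eq_mul, Finset.sum_ite_mem, Finset.inter_eq_right.2 hs, Finset.sum_const, smul_eq_mul]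
  ac_rfl

/-- Unfolding the walk. [cite: MadrasSlade1993, §1.2] -/
theorem tsWalk_succ (T : ℕ) (s : Finset ℕ) (n : ℕ) (sd : Bool) (i₀ : ℕ) :
    tsWalk T s (n + 1) sd i₀ = Zd.concatWalk (tuLen T (decide (i₀ ∈ s))) (tuWalk T sd (decide (i₀ ∈ s)))
      (tsWalk T s n (nside sd (decide (i₀ ∈ s))) (i₀ + 1)) := rfl

/-- The switch walk starts at the origin. [cite: MadrasSlade1993, §1.1] -/
theorem tsWalk_zero (T : ℕ) (s : Finset ℕ) (n : ℕ) (sd : Bool) (i₀ : ℕ) : tsWalk T s n sd i₀ 0 = 0 := by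
  cases n with
  | zero => rfl
  | succ n => rw [tsWalk_succ, concat_of_le (Nat.zero_le _), tuWalk_zero]

/-- The abscissa is non-negative. [cite: MadrasSlade1993, §8.2] -/
theorem tsWalk_apply_zero_nonneg (T : ℕ) (s : Finset ℕ) (n : ℕ) (sd : Bool) (i₀ i : ℕ) : 0 ≤ tsWalk T s n sd i₀ i 0 := by
  induction n generalizing sd i₀ i with
  | zero => simp [tsWalk]
  | succ n ih =>
    rw [tsWalk_succ]
    by_cases h : i ≤ tuLen T (decide (i₀ ∈ s))
    · rw [concat_of_le h, tuWalk_apply_zero]; exact tuX_nonneg _ _ _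
    · rw [concat_of_lt (Nat.not_le.1 h), Pi.add_apply, tuWalk_apply_zero]
      exact add_nonneg (tuX_nonneg _ _ _) (ih _ _ _)

/-- The abscissa is `≥ 1` at every positive time up to the length. [cite: MadrasSlade1993, §8.2] -/
theorem one_le_tsWalk_apply_zero (T : ℕ) (s : Finset ℕ) (n : ℕ) (sd : Bool) (i₀ : ℕ) {i : ℕ} (hi : 1 ≤ i)
    (hin : i ≤ tsLen T s i₀ n) : 1 ≤ tsWalk T s n sd i₀ i 0 := by
  cases n with
  | zero => simp at hin; omega
  | succ n =>
    rw [tsWalk_succ]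
    by_cases h : i ≤ tuLen T (decide (i₀ ∈ s))
    · rw [concat_of_le h, tuWalk_apply_zero]; exact one_le_tuX _ _ hi
    · rw [concat_of_lt (Nat.not_le.1 h), Pi.add_apply, tuWalk_apply_zero]
      have h1 := tsWalk_apply_zero_nonneg T s n (nside sd (decide (i₀ ∈ s))) (i₀ + 1) (i - tuLen T (decide (i₀ ∈ s)))
      have h2 := one_le_tuX T (decide (i₀ ∈ s)) (one_le_tuLen T (decide (i₀ ∈ s)))
      linarith

/-- **Switch walks are self-avoiding walks of `ℤ²`** (the pieces are separated by their abscissae). [cite: MadrasSlade1993, §1.2 (concatenation of walks)] -/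
theorem tsWalk_mem_saws (T : ℕ) (s : Finset ℕ) (n : ℕ) (sd : Bool) (i₀ : ℕ) :
    tsWalk T s n sd i₀ ∈ Zd.saws 2 (tsLen T s i₀ n) := by
  induction n generalizing sd i₀ with
  | zero =>
    rw [tsLen_zero, Zd.mem_saws]
    exact ⟨rfl, fun _ _ => rfl, fun i hi => absurd hi (Nat.not_lt_zero _), fun i hi j hj _ => by
      simp only [Set.mem_setOf_eq, Nat.le_zero] at hi hj; rw [hi, hj]⟩
  | succ n ih =>
    rw [tsLen_succ, tsWalk_succ]
    refine Zd.concatWalk_mem_saws (tuWalk_mem_saws T sd _) (ih _ (i₀ + 1)) fun i hi j hj1 hj2 heq => ?_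
    have h0 := congrFun heq 0
    simp only [Pi.add_apply, tuWalk_apply_zero] at h0
    have h1 := tuX_le T (decide (i₀ ∈ s)) i
    have h2 := one_le_tsWalk_apply_zero T s n (nside sd (decide (i₀ ∈ s))) (i₀ + 1) hj1 hj2
    omega

/-- The rows of a switch walk started on a side stay in `[0, T]`. [cite: MadrasSlade1993, §8.2, eq. (8.2.1)] -/
theorem tsWalk_row (T : ℕ) (s : Finset ℕ) (n : ℕ) (sd : Bool) (i₀ i : ℕ) :
    0 ≤ sideRow T sd + tsWalk T s n sd i₀ i 1 ∧ sideRow T sd + tsWalk T s n sd i₀ i 1 ≤ (T : ℤ) := by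
  induction n generalizing sd i₀ i with
  | zero =>
    cases sd
    · simp [tsWalk, sideRow]
    · simp [tsWalk, sideRow]
  | succ n ih =>
    rw [tsWalk_succ]
    by_cases h : i ≤ tuLen T (decide (i₀ ∈ s))
    · rw [concat_of_le h, tuWalk_apply_one]; exact tuY_row T sd _ _
    · rw [concat_of_lt (Nat.not_le.1 h), Pi.add_apply, tuWalk_apply_one, ← add_assoc, sideRow_add_tuY_tuLen]
      exact ih _ _ _

/-- Placing a concatenation = concatenating the placed first piece with the same second piece. [cite: MadrasSlade1993, §1.2] -/
private theorem add_concatWalk' (a : Site 2) (m : ℕ) (ω υ : ℕ → Site 2) :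
    (fun i => a + Zd.concatWalk m ω υ i) = Zd.concatWalk m (fun i => a + ω i) υ := by
  funext i
  by_cases h : i ≤ m
  · rw [concat_of_le h, concat_of_le h]
  · rw [concat_of_lt (Nat.not_le.1 h), concat_of_lt (Nat.not_le.1 h), add_assoc]

/-- **The placed switch walk steps along brick-wall bonds** (start = a weighted site of its side). [cite: EntingJensen2009, §7.4.2, Fig. 7.10; MadrasSlade1993, §8.2] -/
theorem isBW_tsWalk (hT : 1 ≤ T) (s : Finset ℕ) (n : ℕ) {sd : Bool} (i₀ : ℕ) {a : Site 2} (ha0 : (a 0 + a 1) % 2 = sidePar sd)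
    (ha1 : a 1 = sideRow T sd) : IsBW (tsLen T s i₀ n) (fun i => a + tsWalk T s n sd i₀ i) := by
  induction n generalizing sd i₀ a with
  | zero => intro i hi; simp at hi
  | succ n ih =>
    rw [tsLen_succ, tsWalk_succ, add_concatWalk']
    refine isBW_concatWalk (fun i hi => tuWalk_adj ha0 ha1 _ hi) (tsWalk_zero _ _ _ _ _) fun j hj => ?_
    obtain ⟨-, hb0, hb1⟩ := tuWalk_end_par hT ha0 ha1 (decide (i₀ ∈ s))
    have h := ih (i₀ + 1) hb0 hb1 j hj
    simpa only [add_assoc] using h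

/-! ### The switch walks as members of `S_N(S_T)` -/

/-- The bottom-weighted starting site `(1,0)`. [cite: MadrasSlade1993, §8.2, eq. (8.2.1)] -/
def tsStart : Site 2 := ![1, 0]

/-- Coordinates of the starting site. [cite: MadrasSlade1993, §8.2, eq. (8.2.1)] -/
@[simp] theorem tsStart_apply_zero : tsStart 0 = 1 := rfl

/-- Coordinates of the starting site. [cite: MadrasSlade1993, §8.2, eq. (8.2.1)] -/
@[simp] theorem tsStart_apply_one : tsStart 1 = 0 := rfl

/-- The translation class of the width-`T` switch walk of `s` with `n` units. [cite: MadrasSlade1993, §8.2] -/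
def tsPair (T n : ℕ) (s : Finset ℕ) : Site 2 × (ℕ → Site 2) := (tsStart, tsWalk T s n false 0)

/-- **Switch walks are walks of `S_N(S_T)`, `N = tsLen T s 0 n`.** [cite: MadrasSlade1993, §8.2; BeatonBousquetMelouDeGierDuminilCopinGuttmann2014, §3.2 (arXiv v5 p. 10)] -/
theorem tsPair_mem_stripPairs (hT : 1 ≤ T) (n : ℕ) (s : Finset ℕ) : tsPair T n s ∈ stripPairs T (tsLen T s 0 n) := by
  rw [mem_stripPairs, tsPair]
  refine ⟨mem_stripStarts.2 ⟨⟨by simp, by simp⟩, by simp, by simp⟩,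
    tsWalk_mem_saws T s n false 0, isBW_tsWalk hT s n 0 (by simp [sidePar]) (by simp [sideRow]), fun m _ => ?_⟩
  have h := tsWalk_row T s n false 0 m
  simp only [sideRow, Bool.false_eq_true, ite_false, zero_add] at h
  exact ⟨by simp [h.1], by simpa using h.2⟩

/-- **Each unit adds exactly one weighted site**: `wPos = n` (`T ≥ 1`). [cite: BeatonBousquetMelouDeGierDuminilCopinGuttmann2014, §3.2 (arXiv v5 p. 10)] -/
theorem wPos_tsWalk (hT : 1 ≤ T) (s : Finset ℕ) (n : ℕ) {sd : Bool} (i₀ : ℕ) {a : Site 2} (ha0 : (a 0 + a 1) % 2 = sidePar sd)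
    (ha1 : a 1 = sideRow T sd) : wPos T a (tsWalk T s n sd i₀) (tsLen T s i₀ n) = n := by
  induction n generalizing sd i₀ a with
  | zero => simp [wPos]
  | succ n ih =>
    rw [wPos, tsLen_succ, Finset.sum_range_add, tsWalk_succ]
    set b := decide (i₀ ∈ s) with hb
    have h1 : ∑ j ∈ range (tuLen T b), (if wSite T (a + Zd.concatWalk (tuLen T b) (tuWalk T sd b)
        (tsWalk T s n (nside sd (decide (i₀ ∈ s))) (i₀ + 1)) (j + 1)) then 1 else 0) = 1 := by
      refine Eq.trans (Finset.sum_congr rfl fun j hj => ?_) (sum_tuWalk_wSite hT ha0 ha1 b)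
      rw [concat_of_le (Nat.succ_le_of_lt (Finset.mem_range.1 hj))]
    obtain ⟨-, hb0, hb1⟩ := tuWalk_end_par hT ha0 ha1 b
    have h2 := ih (i₀ + 1) hb0 hb1
    rw [wPos] at h2
    rw [h1, add_comm (1 : ℕ)]
    congr 1
    refine Eq.trans (Finset.sum_congr rfl fun j _ => ?_) h2
    rw [show tuLen T b + j + 1 = tuLen T b + (j + 1) by omega, concat_add (tsWalk_zero _ _ _ _ _), add_assoc]

/-- Bottom + top visit counts = the number of weighted sites visited (`T ≥ 1`: the two walls are distinct rows).
[cite: BeatonBousquetMelouDeGierDuminilCopinGuttmann2014, §3.2 (arXiv v5 p. 10: bc(ω) + tc(ω))] -/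
theorem bottomVisits₀_add_topVisits₀_eq_wSite (hT : 1 ≤ T) (a : Site 2) (υ : ℕ → Site 2) (N : ℕ) :
    bottomVisits₀ a υ N + topVisits₀ T a υ N = (if wSite T (a + υ 0) then 1 else 0) + wPos T a υ N := by
  have hpt : ∀ m ∈ range (N + 1), ((if (a + υ m) 1 = 0 ∧ (a + υ m) 0 % 2 = 1 then 1 else 0) +
      (if (a + υ m) 1 = (T : ℤ) ∧ ((a + υ m) 0 + T) % 2 = 0 then 1 else 0)) = (if wSite T (a + υ m) then 1 else 0) := by
    intro m _
    unfold wSite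
    have hT' : (0 : ℤ) ≠ (T : ℤ) := by exact_mod_cast (show 0 ≠ T by omega)
    split_ifs <;> omega
  unfold bottomVisits₀ topVisits₀ wPos
  calc (∑ m ∈ range (N + 1), (if (a + υ m) 1 = 0 ∧ (a + υ m) 0 % 2 = 1 then 1 else 0)) +
        ∑ m ∈ range (N + 1), (if (a + υ m) 1 = (T : ℤ) ∧ ((a + υ m) 0 + T) % 2 = 0 then 1 else 0)
      = ∑ m ∈ range (N + 1), ((if (a + υ m) 1 = 0 ∧ (a + υ m) 0 % 2 = 1 then 1 else 0) +
          (if (a + υ m) 1 = (T : ℤ) ∧ ((a + υ m) 0 + T) % 2 = 0 then 1 else 0)) := Finset.sum_add_distrib.symm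
    _ = ∑ m ∈ range (N + 1), (if wSite T (a + υ m) then 1 else 0) := Finset.sum_congr rfl hpt
    _ = (if wSite T (a + υ 0) then 1 else 0) + ∑ j ∈ range N, (if wSite T (a + υ (j + 1)) then 1 else 0) := by
        rw [Finset.sum_range_succ', add_comm]

/-- **The switch walk of `n` units has exactly `n + 1` weighted vertices**: `bc + tc = n + 1` (`T ≥ 1`). [cite: BeatonBousquetMelouDeGierDuminilCopinGuttmann2014, §3.2 (arXiv v5 p. 10: y^{bc(ω)} z^{tc(ω)})] -/
theorem bottomVisits₀_add_topVisits₀_tsWalk (hT : 1 ≤ T) (n : ℕ) (s : Finset ℕ) :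
    bottomVisits₀ tsStart (tsWalk T s n false 0) (tsLen T s 0 n) + topVisits₀ T tsStart (tsWalk T s n false 0) (tsLen T s 0 n) = n + 1 := by
  rw [bottomVisits₀_add_topVisits₀_eq_wSite hT, wPos_tsWalk hT s n 0 (by simp [sidePar]) (by simp [sideRow]), tsWalk_zero, add_zero]
  have hw : wSite T tsStart := Or.inl ⟨by simp, by simp⟩
  rw [if_pos hw, add_comm]

/-- The tail of a switch walk is read off the walk: `W'(i) = W(i + m) − U(m)`. [cite: MadrasSlade1993, §1.2] -/
private theorem tsWalk_tail (T : ℕ) (s : Finset ℕ) (n : ℕ) (sd : Bool) (i₀ i : ℕ) :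
    tsWalk T s n (nside sd (decide (i₀ ∈ s))) (i₀ + 1) i =
      tsWalk T s (n + 1) sd i₀ (tuLen T (decide (i₀ ∈ s)) + i) - tuWalk T sd (decide (i₀ ∈ s)) (tuLen T (decide (i₀ ∈ s))) := by
  rw [tsWalk_succ, concat_add (tsWalk_zero _ _ _ _ _), add_sub_cancel_left]

/-- **Distinct switch sets give distinct walks** (unit `i₀` is read off the abscissa at time `2`; `T ≥ 1`). [cite: MadrasSlade1993, §8.2] -/
theorem tsWalk_decode (hT : 1 ≤ T) (n : ℕ) {s s' : Finset ℕ} {sd : Bool} {i₀ : ℕ} (h : tsWalk T s n sd i₀ = tsWalk T s' n sd i₀) :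
    ∀ i, i₀ ≤ i → i < i₀ + n → (i ∈ s ↔ i ∈ s') := by
  induction n generalizing sd i₀ with
  | zero => intro i h1 h2; omega
  | succ n ih =>
    have hb : decide (i₀ ∈ s) = decide (i₀ ∈ s') := by
      have h2 := congrFun (congrFun h 2) 0
      rw [tsWalk_succ, tsWalk_succ, concat_of_le (two_le_tuLen hT _), concat_of_le (two_le_tuLen hT _), tuWalk_apply_zero,
        tuWalk_apply_zero, tuX_two hT, tuX_two hT] at h2
      revert h2
      cases decide (i₀ ∈ s) <;> cases decide (i₀ ∈ s') <;> simp
    have hmem : (i₀ ∈ s ↔ i₀ ∈ s') := by simpa using hb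
    have htail : tsWalk T s n (nside sd (decide (i₀ ∈ s))) (i₀ + 1) = tsWalk T s' n (nside sd (decide (i₀ ∈ s))) (i₀ + 1) := by
      funext i
      have t1 := tsWalk_tail T s n sd i₀ i
      have t2 := tsWalk_tail T s' n sd i₀ i
      rw [← hb] at t2
      rw [t1, t2, h]
    intro i h1 h2
    rcases Nat.eq_or_lt_of_le h1 with h3 | h3
    · subst h3; exact hmem
    · exact ih htail i (by omega) (by omega)

/-- **`tsPair T n` is injective on the switch sets `s ⊆ {0,…,n−1}`** (`T ≥ 1`). [cite: MadrasSlade1993, §8.2] -/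
theorem tsPair_injOn (hT : 1 ≤ T) (n k : ℕ) : Set.InjOn (tsPair T n) ↑((range n).powersetCard k) := by
  intro s hs s' hs' h
  have hs1 := (Finset.mem_powersetCard.1 (Finset.mem_coe.1 hs)).1
  have hs1' := (Finset.mem_powersetCard.1 (Finset.mem_coe.1 hs')).1
  have hw : tsWalk T s n false 0 = tsWalk T s' n false 0 := congrArg Prod.snd h
  ext i
  by_cases hi : i < n
  · exact tsWalk_decode hT n hw i (Nat.zero_le _) (by omega)
  · constructor
    · intro h'; exact absurd (Finset.mem_range.1 (hs1 h')) hi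
    · intro h'; exact absurd (Finset.mem_range.1 (hs1' h')) hi

/-! ### The finite lower bound and the rate -/

/-- **`C(n,k)·y^{n+1} ≤ C_{T,2n+(2T−1)k}(y,y)`** (`T ≥ 1`, `y ≥ 1`). [cite: BeatonBousquetMelouDeGierDuminilCopinGuttmann2014, §3.2 (arXiv v5 p. 10: C_{T,k}(y,z)); MadrasSlade1993, §8.2] -/
theorem choose_mul_pow_le_stripZ₂_self (hT : 1 ≤ T) (hy : 1 ≤ y) (n k : ℕ) :
    ((n.choose k : ℕ) : ℝ) * y ^ (n + 1) ≤ stripZ₂ T (2 * n + (2 * T - 1) * k) y y := by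
  classical
  have hy0 : 0 < y := by linarith
  set S := (range n).powersetCard k with hS
  have hmem : ∀ s ∈ S, tsPair T n s ∈ stripPairs T (2 * n + (2 * T - 1) * k) := by
    intro s hs
    obtain ⟨hsub, hcard⟩ := Finset.mem_powersetCard.1 hs
    have h := tsPair_mem_stripPairs hT n s
    rwa [tsLen_eq hT n hsub, hcard] at h
  have hw : ∀ s ∈ S, y ^ bottomVisits₀ (tsPair T n s).1 (tsPair T n s).2 (2 * n + (2 * T - 1) * k) *
      y ^ topVisits₀ T (tsPair T n s).1 (tsPair T n s).2 (2 * n + (2 * T - 1) * k) = y ^ (n + 1) := by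
    intro s hs
    obtain ⟨hsub, hcard⟩ := Finset.mem_powersetCard.1 hs
    rw [← pow_add, tsPair]
    simp only
    rw [← hcard, ← tsLen_eq hT n hsub, bottomVisits₀_add_topVisits₀_tsWalk hT]
  calc ((n.choose k : ℕ) : ℝ) * y ^ (n + 1) = ∑ s ∈ S, y ^ (n + 1) := by
        rw [Finset.sum_const, hS, Finset.card_powersetCard, Finset.card_range, nsmul_eq_mul]
    _ = ∑ s ∈ S, y ^ bottomVisits₀ (tsPair T n s).1 (tsPair T n s).2 (2 * n + (2 * T - 1) * k) *
          y ^ topVisits₀ T (tsPair T n s).1 (tsPair T n s).2 (2 * n + (2 * T - 1) * k) :=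
        Finset.sum_congr rfl fun s hs => (hw s hs).symm
    _ = ∑ p ∈ S.image (tsPair T n), y ^ bottomVisits₀ p.1 p.2 (2 * n + (2 * T - 1) * k) *
          y ^ topVisits₀ T p.1 p.2 (2 * n + (2 * T - 1) * k) := by
        rw [Finset.sum_image fun s hs s' hs' h => tsPair_injOn hT n k hs hs' h]
    _ ≤ stripZ₂ T (2 * n + (2 * T - 1) * k) y y := by
        rw [stripZ₂]
        refine Finset.sum_le_sum_of_subset_of_nonneg (fun p hp => ?_) fun p _ _ => by positivity
        obtain ⟨s, hs, rfl⟩ := Finset.mem_image.1 hp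
        exact hmem s hs

/-- The finite bound along `N = j(2m+2T−1)`: `(m·y^m)^j ≤ C_{T, j(2m+2T−1)}(y,y)` (`T ≥ 1`, `y ≥ 1`). [cite: BeatonBousquetMelouDeGierDuminilCopinGuttmann2014, §3.2 (arXiv v5 p. 10); MadrasSlade1993, §8.2] -/
theorem mul_pow_pow_le_stripZ₂_self (hT : 1 ≤ T) (hy : 1 ≤ y) (m j : ℕ) :
    ((m : ℝ) * y ^ (m : ℕ)) ^ j ≤ stripZ₂ T (j * (2 * m + 2 * T - 1)) y y := by
  have hy0 : 0 ≤ y := by linarith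
  have h := choose_mul_pow_le_stripZ₂_self hT hy (j * m) j
  have e : 2 * (j * m) + (2 * T - 1) * j = j * (2 * m + 2 * T - 1) := by
    zify [hT, (by omega : 1 ≤ 2 * m + 2 * T)]
    push_cast [Nat.cast_sub (by omega : 1 ≤ 2 * T)]
    ring
  rw [e] at h
  have hc : ((m : ℝ) ^ j) ≤ ((j * m).choose j : ℕ) := by
    rw [mul_comm j m]; exact_mod_cast Zd.pow_le_choose_mul m j
  calc ((m : ℝ) * y ^ (m : ℕ)) ^ j = (m : ℝ) ^ j * y ^ (j * m) := by rw [mul_pow, ← pow_mul, mul_comm m j]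
    _ ≤ ((j * m).choose j : ℕ) * y ^ (j * m) := mul_le_mul_of_nonneg_right hc (by positivity)
    _ ≤ ((j * m).choose j : ℕ) * y ^ (j * m + 1) :=
        mul_le_mul_of_nonneg_left (pow_le_pow_right₀ hy (Nat.le_succ _)) (by positivity)
    _ ≤ stripZ₂ T (j * (2 * m + 2 * T - 1)) y y := h

/-- **`(m·y^m)^{1/(2m+2T−1)} ≤ μ_T(y,y)`** for every `T ≥ 1`, `m ≥ 1`, `y ≥ 1`. [cite: BeatonBousquetMelouDeGierDuminilCopinGuttmann2014, Proposition 6 (arXiv v5 p. 10: μ_T(y,z) = lim C_{T,n}(y,z)^{1/n}); MadrasSlade1993, §8.2, (8.2.2)–(8.2.3)] -/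
theorem rpow_le_stripMuY₂_self (hT : 1 ≤ T) (hy : 1 ≤ y) {m : ℕ} (hm : 1 ≤ m) :
    ((m : ℝ) * y ^ (m : ℕ)) ^ (1 / (2 * (m : ℝ) + 2 * (T : ℝ) - 1)) ≤ stripMuY₂ T y y := by
  have hy0 : 0 < y := by linarith
  have hL := tendsto_stripZ₂_rpow T hy0 hy0
  have hφt : Tendsto (fun j : ℕ => (j + 1) * (2 * m + 2 * T - 1)) atTop atTop :=
    tendsto_atTop_mono (fun j => by show j ≤ (j + 1) * (2 * m + 2 * T - 1); nlinarith [(by omega : 1 ≤ 2 * m + 2 * T - 1)])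
      tendsto_id
  have hL' := hL.comp hφt
  refine ge_of_tendsto' hL' fun j => ?_
  simp only [Function.comp]
  have hc0 : (0 : ℝ) ≤ (m : ℝ) * y ^ (m : ℕ) := by positivity
  have hN : ((((j + 1) * (2 * m + 2 * T - 1) : ℕ) : ℝ)) = ((j : ℝ) + 1) * (2 * (m : ℝ) + 2 * (T : ℝ) - 1) := by
    rw [Nat.cast_mul, Nat.cast_sub (by omega : 1 ≤ 2 * m + 2 * T)]; push_cast; ring
  have hpos : (0 : ℝ) < 2 * (m : ℝ) + 2 * (T : ℝ) - 1 := by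
    have : (1 : ℝ) ≤ m := by exact_mod_cast hm
    have : (1 : ℝ) ≤ T := by exact_mod_cast hT
    linarith
  have e : ((m : ℝ) * y ^ (m : ℕ)) ^ (1 / (2 * (m : ℝ) + 2 * (T : ℝ) - 1)) =
      ((((m : ℝ) * y ^ (m : ℕ)) ^ (j + 1) : ℝ)) ^ (1 / ((((j + 1) * (2 * m + 2 * T - 1) : ℕ) : ℝ))) := by
    rw [hN, ← Real.rpow_natCast ((m : ℝ) * y ^ (m : ℕ)) (j + 1), ← Real.rpow_mul hc0]
    congr 1
    push_cast
    field_simp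
  rw [e]
  exact Real.rpow_le_rpow (by positivity) (mul_pow_pow_le_stripZ₂_self hT hy m (j + 1)) (by positivity)

/-- **`m·y^m ≤ μ_T(y,y)^{2m+2T−1}`** (`T ≥ 1`, `m ≥ 1`, `y ≥ 1`). [cite: BeatonBousquetMelouDeGierDuminilCopinGuttmann2014, Proposition 6 (arXiv v5 p. 10)] -/
theorem mul_pow_le_stripMuY₂_self_pow (hT : 1 ≤ T) (hy : 1 ≤ y) {m : ℕ} (hm : 1 ≤ m) :
    (m : ℝ) * y ^ (m : ℕ) ≤ stripMuY₂ T y y ^ (2 * m + 2 * T - 1) := by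
  have hy0 : 0 < y := by linarith
  have hμ := (stripMuY₂_pos T hy0 hy0).le
  have hc0 : (0 : ℝ) ≤ (m : ℝ) * y ^ (m : ℕ) := by positivity
  have h := rpow_le_stripMuY₂_self hT hy hm
  have hpos : (0 : ℝ) < 2 * (m : ℝ) + 2 * (T : ℝ) - 1 := by
    have : (1 : ℝ) ≤ m := by exact_mod_cast hm
    have : (1 : ℝ) ≤ T := by exact_mod_cast hT
    linarith
  have hN : (((2 * m + 2 * T - 1 : ℕ) : ℝ)) = 2 * (m : ℝ) + 2 * (T : ℝ) - 1 := by
    rw [Nat.cast_sub (by omega : 1 ≤ 2 * m + 2 * T)]; push_cast; ring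
  have e : (m : ℝ) * y ^ (m : ℕ) = (((m : ℝ) * y ^ (m : ℕ)) ^ (1 / (2 * (m : ℝ) + 2 * (T : ℝ) - 1))) ^ (2 * m + 2 * T - 1) := by
    rw [← Real.rpow_natCast (((m : ℝ) * y ^ (m : ℕ)) ^ (1 / (2 * (m : ℝ) + 2 * (T : ℝ) - 1))) (2 * m + 2 * T - 1),
      ← Real.rpow_mul hc0, hN, one_div_mul_cancel hpos.ne', Real.rpow_one]
  rw [e]
  exact pow_le_pow_left₀ (by positivity) h _

/-- **`√y < μ_T(y,y)` for EVERY width `T ≥ 1` and every `y ≥ 1`** (take `m = ⌊y^T⌋₊ + 1 > y^T`: `μ_T^{2m+2T−1} ≥ m·y^m > y^{m+T} ≥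
√y^{2m+2T−1}`). [cite: BeatonBousquetMelouDeGierDuminilCopinGuttmann2014, §3.1 Proposition 5 (arXiv v5 p. 9: the zig-zag bound √y) and §3.2 Proposition 7 (one weighted wall)] -/
theorem sqrt_lt_stripMuY₂_self (hT : 1 ≤ T) (hy : 1 ≤ y) : Real.sqrt y < stripMuY₂ T y y := by
  have hy0 : 0 < y := by linarith
  have hμ := (stripMuY₂_pos T hy0 hy0).le
  set m : ℕ := ⌊y ^ T⌋₊ + 1 with hm
  have hm1 : 1 ≤ m := by omega
  have hmy : y ^ T < m := by rw [hm]; push_cast; exact Nat.lt_floor_add_one _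
  have hs0 : 0 ≤ Real.sqrt y := Real.sqrt_nonneg y
  have hsy : Real.sqrt y ≤ y := by rw [Real.sqrt_le_left (by linarith)]; nlinarith
  have hs1 : 1 ≤ Real.sqrt y := by rw [show (1 : ℝ) = Real.sqrt 1 by simp]; exact Real.sqrt_le_sqrt hy
  have h := mul_pow_le_stripMuY₂_self_pow hT hy hm1
  have hlt : Real.sqrt y ^ (2 * m + 2 * T - 1) < stripMuY₂ T y y ^ (2 * m + 2 * T - 1) := by
    have e : Real.sqrt y ^ (2 * m + 2 * T - 1) = Real.sqrt y ^ (2 * (T - 1) + 1) * y ^ (m : ℕ) := by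
      rw [show 2 * m + 2 * T - 1 = 2 * (T - 1) + 1 + 2 * m by omega, pow_add, pow_mul (Real.sqrt y) 2 m, Real.sq_sqrt hy0.le]
    have h1 : Real.sqrt y ^ (2 * (T - 1) + 1) ≤ y ^ T := by
      calc Real.sqrt y ^ (2 * (T - 1) + 1) = y ^ (T - 1) * Real.sqrt y := by
            rw [pow_add, pow_one, pow_mul, Real.sq_sqrt hy0.le]
        _ ≤ y ^ (T - 1) * y := mul_le_mul_of_nonneg_left hsy (by positivity)
        _ = y ^ T := by rw [← pow_succ, Nat.sub_add_cancel hT]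
    rw [e]
    calc Real.sqrt y ^ (2 * (T - 1) + 1) * y ^ (m : ℕ) ≤ y ^ T * y ^ (m : ℕ) := mul_le_mul_of_nonneg_right h1 (by positivity)
      _ < m * y ^ (m : ℕ) := mul_lt_mul_of_pos_right hmy (by positivity)
      _ ≤ stripMuY₂ T y y ^ (2 * m + 2 * T - 1) := h
  exact lt_of_pow_lt_pow_left₀ _ hμ hlt

end Literature.Probability.RandomPlanarGeometry.SAW.HexBW
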